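import Summits.NavierStokesRegularity.FunctionalMining.TopEigHeatMollifiedLine
import HarnessLib

/-!
# FunctionalMining — the OPTIMAL LAMINATE CEILING on Lemma L-λ's constant:
# `C_λ(q) ≤ 16π²(q−1)/q` (and `C_λ^−(q)`, `C_λ^sym(q) ≤ 16π²(q−1)/q`) for EVERY real `q ≥ 1`

HONEST FRAMING. Search for candidate a priori estimates; no regularity claim. Nothing about
Navier–Stokes is proved or asserted in this file. Cell `pub-nsfunc`, prove seat (gen 31), own lane; sequel of
`TopEigHeatMollifiedLine.lean` (the mollified optimal laminate `F′_ε = S·(S² + ε)^{1/q−1/2}`, `S = sin 2π·`, and the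
per-`ε` ceilings `C_λ(q) ≤ R_ε(q) = −4π²q·N_ε(q)/D_ε(q)`). `C_λ(q) = TopEig.topEigHeatRate q` is the dictionary's
STATIC heat-line constant of `Φ_q = ∫(λ₁⁺)^q` (`TopEigHeatRate.lean`), `C_λ^sym(q) = topBotEigHeatRate q` K6's.

CONTENT.
* §1 BOOKING per `ε` (K33b's pattern: `topEigHeatRate_le_ratio`, K6 `topBotEigHeatRate_le_ratio`, K33a
  `heatDissipation_le_of_line`, with the line formula `topEigMoment_line_half` and the drop `integral_mollLine_drop_le`):
  **`topEigHeatRate_le_mollRate : C_λ(q) ≤ R_ε(q)`**, `negBotEigHeatRate_le_mollRate`, `topBotEigHeatRate_le_mollRate`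
  for every real `q ≥ 1` and every `ε > 0` (the witness laminate is smooth, divergence free, zero-mean, `Φ_q > 0`);
* §2 UNIFORM BOUNDS (`0 < ε ≤ 1`, `q ≥ 1`; `|α| ≤ ½`, `S² ≤ W ≤ 2`): `|B(α; S², W)| ≤ 14·W`, hence the Bernoulli
  numerator integrand obeys **`|(|S|^q W^{−1−q/2} B)| ≤ 14`** and the denominator integrand `0 ≤ |S|^qW^{1−q/2} ≤ 2`
  — both dominated by CONSTANTS, uniformly in `ε` (the design point of the mollification);
* §3 POINTWISE LIMITS off the zero set of `S` (a Lebesgue-null set, `ae_sin_two_pi_mul_ne_zero`): as `ε ↓ 0`,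
  `|S|^qW^{1−q/2} → S²` and `|S|^qW^{−1−q/2}B(α; S², W) → (1+2α)(2α − (1+2α)S²)`;
* §4 DOMINATED CONVERGENCE (`intervalIntegral.tendsto_integral_filter_of_dominated_convergence` along `𝓝[>] 0`):
  **`D_ε(q) → ∫₀¹S² = ½`** and **`N_ε(q) → ∫₀¹(1+2α)(2α − (1+2α)S²) = 2(1−q)/q²`**, so
  **`R_ε(q) → 16π²(q−1)/q`** (`tendsto_mollRate`);
* §5 THE CEILING (`ge_of_tendsto` on §4 and the per-`ε` bookings of §1): for every real `q ≥ 1`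
  **`topEigHeatRate_le_optimal : C_λ(q) ≤ 16π²(q−1)/q`**, `negBotEigHeatRate_le_optimal`,
  **`topBotEigHeatRate_le_optimal : C_λ^sym(q) ≤ 16π²(q−1)/q`**, the window `C_λ(q) ∈ [0, 16π²(q−1)/q]`, and in
  no-go words `not_topEigHeatCoercive_of_optimal_lt : 16π²(q−1)/q < c → ¬ TopEigHeatCoercive q c`;
* §6 COMPARISONS (exact arithmetic): `16π²(q−1)/q ≤ 4π²q` with equality iff `q = 2` (`(q−2)² ≥ 0`: the Poincaré
  ceiling of `TopEigHeatRate.lean` is recovered at `q = 2` and beaten everywhere else); `16π²(q−1)/q ≤ 18π²(q−1)`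
  (K33b's linear bound) and `16π²(q−1)/q < 36π²q(q−1)/(3q−1)` for `q > 1` (K33b's `R_λ(q)`; `(3q−2)² > 0`); at the
  endpoint `q = 1` the bound reads `C_λ(1) ≤ 0`, K32's value `C_λ(1) = 0`; sample windows `C_λ(3/2) ≤ 16π²/3`,
  `C_λ(3) ≤ 32π²/3`, `C_λ(4) ≤ 12π²` (K34b: `(5796/509)π² ≈ 11.4π²` at `q = 3`, `(128/9)π² ≈ 14.2π²` at `q = 4`).

MEANING. `16π²(q−1)/q = (4(q−1)/q)·4π²` is the pen OPTIMUM of the heat price over all `x₂`-laminates (no-go seat's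
LAMINATE-Q1-NOTE (ii): `price/Φ_q = (4(q−1)/q)·∫H′²/∫H²`, `H = |F′|^{q/2}sgn F′`, minimised by `H = sin`, i.e. by
the NON-smooth profile `F′ = |S|^{2/q}sgn S`); with the no-go seat's FLOOR `(16π²(q−1)/q)·Φ_q(u_F) ≤ heatDissipation
Φ_q u_F` on the laminate class (K40b/K40d, via the lit seat's half-shift Wirtinger inequality) the laminate class is
now EXHAUSTED EXACTLY in the kernel: no laminate argument can move `C_λ(q)` below or above `16π²(q−1)/q`. Beating
it needs NON-laminate fields.

SCOPE, EXACTLY: UPPER bounds on `C_λ(q)`, `C_λ^−(q)`, `C_λ^sym(q)`. No lower bound is proved: Lemma L-λ(q)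
(`C_λ(q) > 0`, `@[conjecture] TopEig.TopEigHeatCoercivePos q`) stays OPEN in the kernel for every real `q > 1`; no
node of the cell is decided; nothing about `q < 1`; the mollified laminates are NOT kills (positive heat price).
[ours] = §§ 1–6; folklore = dominated convergence, `∫₀¹sin²(2πs)ds = ½`, countable sets are Lebesgue-null.
FILING (prove seat g31, SLOT OWN-M2, LEAD (ρρρρρρρρ) INBOX l.5608): = staged `pub-nsfunc-prove/staged/g31-own/TopEigHeatMollifiedCeiling.lean` df2043be71e14073; this line is the only addition.
-/

noncomputable section

open MeasureTheory Set intervalIntegral Real Filter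
open scoped ContDiff Topology

namespace Summit.NavierStokesRegularity.FunctionalMining

open Literature.Analysis Literature.Analysis.FunctionSpaces Literature.Analysis.FunctionSpaces.Torus
open TopEig PlanarTopEig StrainL4 LaminateDirection LaminateWindow

namespace TopEigLaminate

variable {q ε : ℝ}

/-! ## 1. Booking per `ε`: `C_λ(q) ≤ R_ε(q)`, `C_λ^−(q) ≤ R_ε(q)`, `C_λ^sym(q) ≤ R_ε(q)` -/

section Booking

variable (hε : 0 < ε)

/-- **`Φ_q(u_F) − Φ_q(u_F + tΔu_F) ≤ t·R_ε(q)·Φ_q(u_F)`** and the same for `Ψ_q` (`q ≥ 1`, every `t`). [ours] -/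
theorem mollMoment_drop_le (hq : 1 ≤ q) (t : ℝ) :
    torusTopEigMoment q (lamU (mollF q ε hε)) -
          torusTopEigMoment q (lamU (mollF q ε hε) + t • Torus.laplacian (lamU (mollF q ε hε))) ≤
        t * (mollRate q ε * torusTopEigMoment q (lamU (mollF q ε hε))) ∧
      torusNegBotEigMoment q (lamU (mollF q ε hε)) -
          torusNegBotEigMoment q (lamU (mollF q ε hε) + t • Torus.laplacian (lamU (mollF q ε hε))) ≤
        t * (mollRate q ε * torusNegBotEigMoment q (lamU (mollF q ε hε))) := by
  have hq0 : 0 < q := by linarith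
  obtain ⟨h0, h0'⟩ := topEigMoment_line_half (mollF q ε hε) 0 hq0
  obtain ⟨ht, ht'⟩ := topEigMoment_line_half (mollF q ε hε) t hq0
  rw [zero_smul, add_zero] at h0 h0'
  have hd := mul_le_mul_of_nonneg_left (integral_mollLine_drop_le hε hq t) (le_of_lt (rpow_pos_of_pos
    (by norm_num : (0 : ℝ) < 1 / 2) q))
  rw [h0, ht, h0', ht']
  constructor <;> nlinarith [hd]

/-- **`Φ_q(u_F) > 0`** and `Ψ_q(u_F) > 0` (`q > 0`). [ours, bookkeeping] -/
theorem moment_lamU_mollF_pos (hq : 0 < q) :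
    0 < torusTopEigMoment q (lamU (mollF q ε hε)) ∧ 0 < torusNegBotEigMoment q (lamU (mollF q ε hε)) := by
  obtain ⟨h0, h0'⟩ := topEigMoment_line_half (mollF q ε hε) 0 hq
  rw [zero_smul, add_zero] at h0 h0'
  have hD := mollDen_pos (q := q) hε hq.le
  rw [← integral_mollF_rpow_zero hε hq] at hD
  have h := mul_pos (rpow_pos_of_pos (by norm_num : (0 : ℝ) < 1 / 2) q) hD
  exact ⟨h0 ▸ h, h0' ▸ h⟩

/-- **THEOREM (mollified ceiling, per `ε`). `C_λ(q) ≤ R_ε(q)` for every real `q ≥ 1` and every `ε > 0`.** [ours] -/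
theorem topEigHeatRate_le_mollRate (hq : 1 ≤ q) (hε : 0 < ε) : topEigHeatRate q ≤ mollRate q ε := by
  have hΦ := (moment_lamU_mollF_pos hε (by linarith : (0 : ℝ) < q)).1
  have h := topEigHeatRate_le_ratio hq (lamU (mollF q ε hε)) (isSmooth_lamU _) (isDivFree_lamU _)
    (hasZeroMean_lamU_mollF hε) hΦ
  refine h.trans ((div_le_iff₀ hΦ).2 ?_)
  exact heatDissipation_le_of_line fun t _ => (mollMoment_drop_le hε hq t).1

/-- **`C_λ^−(q) ≤ R_ε(q)`** (`q ≥ 1`, `ε > 0`). [ours] -/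
theorem negBotEigHeatRate_le_mollRate (hq : 1 ≤ q) (hε : 0 < ε) : negBotEigHeatRate q ≤ mollRate q ε := by
  rw [negBotEigHeatRate_eq]; exact topEigHeatRate_le_mollRate hq hε

/-- **`C_λ^sym(q) ≤ R_ε(q)`** (`q ≥ 1`, `ε > 0`; the symmetrised core `Φ_q + Ψ_q`, K6's window). [ours] -/
theorem topBotEigHeatRate_le_mollRate (hq : 1 ≤ q) (hε : 0 < ε) : topBotEigHeatRate q ≤ mollRate q ε := by
  obtain ⟨hΦ, hΨ⟩ := moment_lamU_mollF_pos hε (by linarith : (0 : ℝ) < q)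
  have hpos : 0 < topBotEigMoment q (lamU (mollF q ε hε)) := by
    unfold topBotEigMoment; exact add_pos hΦ hΨ
  have h := topBotEigHeatRate_le_ratio hq (lamU (mollF q ε hε)) (isSmooth_lamU _) (isDivFree_lamU _)
    (hasZeroMean_lamU_mollF hε) hpos
  refine h.trans ((div_le_iff₀ hpos).2 ?_)
  unfold topBotEigMoment
  rw [mul_add]
  exact add_le_add (heatDissipation_le_of_line fun t _ => (mollMoment_drop_le hε hq t).1)
    (heatDissipation_le_of_line fun t _ => (mollMoment_drop_le hε hq t).2)

/-- **Every rate above some `R_ε(q)` is REFUTED for `∫(λ₁⁺)^q`**: `R_ε(q) < c → ¬ TopEigHeatCoercive q c`. [ours] -/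
theorem not_topEigHeatCoercive_of_mollRate_lt (hq : 1 ≤ q) (hε : 0 < ε) {c : ℝ} (hc : mollRate q ε < c) :
    ¬ TopEigHeatCoercive (d := Fin 3) q c := fun h =>
  not_le.2 (hc.trans_le' (topEigHeatRate_le_mollRate hq hε)) ((topEigHeatCoercive_iff_le_rate hq).1 h)

end Booking

/-! ## 2. Uniform bounds for `0 < ε ≤ 1`, `q ≥ 1` -/

/-- `|α| ≤ ½` for `q ≥ 1`. [ours, bookkeeping] -/
theorem abs_mollExp_le (hq : 1 ≤ q) : |mollExp q| ≤ 1 / 2 := by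
  unfold mollExp
  have h1 : 0 < 1 / q := by positivity
  have h2 : 1 / q ≤ 1 := (div_le_one (by linarith)).2 hq
  rw [abs_le]; constructor <;> linarith

/-- **`|B(α; x, W)| ≤ 14·W`** for `|α| ≤ ½`, `0 ≤ x ≤ 1`, `x ≤ W ≤ 2`. [ours] -/
theorem abs_mollB_le {a x W : ℝ} (ha : |a| ≤ 1 / 2) (hx0 : 0 ≤ x) (hx1 : x ≤ 1) (hxW : x ≤ W) (hW2 : W ≤ 2) :
    |mollB a x W| ≤ 14 * W := by
  have hW0 : 0 ≤ W := hx0.trans hxW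
  obtain ⟨ha1, ha2⟩ := abs_le.1 ha
  have h1 : |W + 2 * a * x| ≤ 2 * W := by
    rw [abs_le]; constructor <;> nlinarith
  have t1 : |W * (W + 2 * a * x)| ≤ 4 * W := by
    rw [abs_mul, abs_of_nonneg hW0]; nlinarith [abs_nonneg (W + 2 * a * x)]
  have t2 : |2 * (a - 1) * (1 - x) * (W + 2 * a * x)| ≤ 6 * W := by
    rw [abs_mul, abs_mul, abs_mul, abs_of_nonneg (by linarith : (0 : ℝ) ≤ 1 - x), abs_two]
    have : |a - 1| ≤ 3 / 2 := by rw [abs_le]; constructor <;> linarith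
    nlinarith [abs_nonneg (a - 1), abs_nonneg (W + 2 * a * x), mul_nonneg (abs_nonneg (a - 1)) (abs_nonneg
      (W + 2 * a * x)), mul_le_mul this h1 (abs_nonneg _) (by norm_num)]
  have t3 : |2 * (1 + 2 * a) * (1 - x) * W| ≤ 4 * W := by
    rw [abs_mul, abs_mul, abs_mul, abs_of_nonneg (by linarith : (0 : ℝ) ≤ 1 - x), abs_two, abs_of_nonneg hW0]
    have : |1 + 2 * a| ≤ 2 := by rw [abs_le]; constructor <;> linarith
    nlinarith [abs_nonneg (1 + 2 * a), mul_nonneg (abs_nonneg (1 + 2 * a)) hW0]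
  unfold mollB
  calc |-(W * (W + 2 * a * x)) + 2 * (a - 1) * (1 - x) * (W + 2 * a * x) + 2 * (1 + 2 * a) * (1 - x) * W|
      ≤ |-(W * (W + 2 * a * x)) + 2 * (a - 1) * (1 - x) * (W + 2 * a * x)| + |2 * (1 + 2 * a) * (1 - x) * W| :=
        abs_add_le _ _
    _ ≤ (|-(W * (W + 2 * a * x))| + |2 * (a - 1) * (1 - x) * (W + 2 * a * x)|) + |2 * (1 + 2 * a) * (1 - x) * W| :=
        by gcongr; exact abs_add_le _ _
    _ ≤ 4 * W + 6 * W + 4 * W := by rw [abs_neg]; gcongr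
    _ = 14 * W := by ring

/-- `|S|^q·W^{−q/2} ≤ 1` (`q ≥ 0`, `ε > 0`): `|S|^q = (S²)^{q/2} ≤ W^{q/2}`. [ours, bookkeeping] -/
theorem abs_sin_rpow_mul_mollBase_rpow_le_one (hq : 0 ≤ q) (hε : 0 < ε) (s : ℝ) :
    |sin (2 * π * s)| ^ q * mollBase ε s ^ (-(q / 2)) ≤ 1 := by
  have hW := mollBase_pos hε s
  have h1 : |sin (2 * π * s)| ^ q = (sin (2 * π * s) ^ 2) ^ (q / 2) := by
    rw [← sq_abs, ← rpow_two, ← rpow_mul (abs_nonneg _)]; ring_nf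
  have h2 : (sin (2 * π * s) ^ 2) ^ (q / 2) ≤ mollBase ε s ^ (q / 2) :=
    rpow_le_rpow (sq_nonneg _) (sin_sq_le_mollBase hε.le s) (by linarith)
  rw [h1, rpow_neg hW.le, ← div_eq_mul_inv, div_le_one (rpow_pos_of_pos hW _)]
  exact h2

/-- **The numerator integrand is bounded by `14`** (`q ≥ 1`, `0 < ε ≤ 1`). [ours] -/
theorem abs_mollNumIntegrand_le (hq : 1 ≤ q) (hε : 0 < ε) (hε1 : ε ≤ 1) (s : ℝ) :
    |(|sin (2 * π * s)| ^ q * mollBase ε s ^ (-1 - q / 2) * mollB (mollExp q) (sin (2 * π * s) ^ 2) (mollBase ε s))|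
      ≤ 14 := by
  have hW := mollBase_pos hε s
  have hB := abs_mollB_le (abs_mollExp_le hq) (sq_nonneg (sin (2 * π * s))) (sin_sq_le_one _)
    (sin_sq_le_mollBase hε.le s) ((mollBase_le ε s).trans (by linarith))
  have hk := abs_sin_rpow_mul_mollBase_rpow_le_one (q := q) (by linarith) hε s
  have e : mollBase ε s ^ (-1 - q / 2) = mollBase ε s ^ (-(q / 2)) * (mollBase ε s)⁻¹ := by
    rw [show (-1 - q / 2 : ℝ) = -(q / 2) + (-1) by ring, rpow_add hW, rpow_neg_one]
  rw [e, abs_mul, abs_mul, abs_mul, abs_of_nonneg (rpow_nonneg (abs_nonneg _) _), abs_of_nonneg (rpow_nonneg hW.le _),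
    abs_of_pos (inv_pos.2 hW)]
  calc |sin (2 * π * s)| ^ q * (mollBase ε s ^ (-(q / 2)) * (mollBase ε s)⁻¹) *
        |mollB (mollExp q) (sin (2 * π * s) ^ 2) (mollBase ε s)|
      ≤ |sin (2 * π * s)| ^ q * (mollBase ε s ^ (-(q / 2)) * (mollBase ε s)⁻¹) * (14 * mollBase ε s) := by
        gcongr
    _ = 14 * (|sin (2 * π * s)| ^ q * mollBase ε s ^ (-(q / 2))) := by field_simp
    _ ≤ 14 * 1 := by gcongr
    _ = 14 := by ring

/-- **The denominator integrand lies in `[0, 2]`** (`q ≥ 0`, `0 < ε ≤ 1`). [ours] -/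
theorem mollDenIntegrand_mem (hq : 0 ≤ q) (hε : 0 < ε) (hε1 : ε ≤ 1) (s : ℝ) :
    0 ≤ |sin (2 * π * s)| ^ q * mollBase ε s ^ (1 - q / 2) ∧
      |sin (2 * π * s)| ^ q * mollBase ε s ^ (1 - q / 2) ≤ 2 := by
  have hW := mollBase_pos hε s
  refine ⟨mul_nonneg (rpow_nonneg (abs_nonneg _) _) (rpow_nonneg hW.le _), ?_⟩
  have e : mollBase ε s ^ (1 - q / 2) = mollBase ε s ^ (-(q / 2)) * mollBase ε s := by
    rw [show (1 - q / 2 : ℝ) = -(q / 2) + 1 by ring, rpow_add hW, rpow_one]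
  rw [e, ← mul_assoc]
  calc |sin (2 * π * s)| ^ q * mollBase ε s ^ (-(q / 2)) * mollBase ε s ≤ 1 * mollBase ε s := by
        gcongr; exact abs_sin_rpow_mul_mollBase_rpow_le_one hq hε s
    _ ≤ 2 := by rw [one_mul]; exact (mollBase_le ε s).trans (by linarith)

/-! ## 3. Pointwise limits as `ε ↓ 0` off the zero set of `S` -/

/-- `W_ε(s) → S²` as `ε → 0`. [ours, bookkeeping] -/
theorem tendsto_mollBase (s : ℝ) : Tendsto (fun ε => mollBase ε s) (𝓝 0) (𝓝 (sin (2 * π * s) ^ 2)) := by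
  have h : Tendsto (fun ε : ℝ => sin (2 * π * s) ^ 2 + ε) (𝓝 0) (𝓝 (sin (2 * π * s) ^ 2 + 0)) :=
    tendsto_const_nhds.add tendsto_id
  rw [add_zero] at h; exact h

/-- `|S|^q = (S²)^{q/2}`. [folklore] -/
theorem abs_sin_rpow_eq_sq_rpow (q s : ℝ) : |sin (2 * π * s)| ^ q = (sin (2 * π * s) ^ 2) ^ (q / 2) := by
  rw [← sq_abs, ← rpow_two, ← rpow_mul (abs_nonneg _)]; ring_nf

/-- **`|S|^q W_ε^{1−q/2} → S²`** as `ε ↓ 0`, at every `s` with `S(s) ≠ 0`. [ours] -/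
theorem tendsto_mollDenIntegrand {s : ℝ} (hS : sin (2 * π * s) ≠ 0) :
    Tendsto (fun ε => |sin (2 * π * s)| ^ q * mollBase ε s ^ (1 - q / 2)) (𝓝[>] 0)
      (𝓝 (sin (2 * π * s) ^ 2)) := by
  have hx : 0 < sin (2 * π * s) ^ 2 := by positivity
  have h := ((tendsto_mollBase s).rpow_const (p := 1 - q / 2) (Or.inl hx.ne')).const_mul
    (|sin (2 * π * s)| ^ q)
  have e : |sin (2 * π * s)| ^ q * (sin (2 * π * s) ^ 2) ^ (1 - q / 2) = sin (2 * π * s) ^ 2 := by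
    rw [abs_sin_rpow_eq_sq_rpow, ← rpow_add hx, show (q / 2 + (1 - q / 2) : ℝ) = 1 by ring, rpow_one]
  rw [e] at h
  exact h.mono_left nhdsWithin_le_nhds

/-- **`|S|^q W_ε^{−1−q/2} B(α; S², W_ε) → (1+2α)(2α − (1+2α)S²)`** as `ε ↓ 0`, at every `s` with `S(s) ≠ 0`. [ours] -/
theorem tendsto_mollNumIntegrand {s : ℝ} (hS : sin (2 * π * s) ≠ 0) :
    Tendsto (fun ε => |sin (2 * π * s)| ^ q * mollBase ε s ^ (-1 - q / 2) *
        mollB (mollExp q) (sin (2 * π * s) ^ 2) (mollBase ε s)) (𝓝[>] 0)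
      (𝓝 ((1 + 2 * mollExp q) * (2 * mollExp q - (1 + 2 * mollExp q) * sin (2 * π * s) ^ 2))) := by
  have hx : 0 < sin (2 * π * s) ^ 2 := by positivity
  have hBc : Continuous fun W : ℝ => mollB (mollExp q) (sin (2 * π * s) ^ 2) W := by unfold mollB; fun_prop
  have h := (((tendsto_mollBase s).rpow_const (p := -1 - q / 2) (Or.inl hx.ne')).const_mul
    (|sin (2 * π * s)| ^ q)).mul ((hBc.tendsto _).comp (tendsto_mollBase s))
  have e : |sin (2 * π * s)| ^ q * (sin (2 * π * s) ^ 2) ^ (-1 - q / 2) *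
      mollB (mollExp q) (sin (2 * π * s) ^ 2) (sin (2 * π * s) ^ 2) =
      (1 + 2 * mollExp q) * (2 * mollExp q - (1 + 2 * mollExp q) * sin (2 * π * s) ^ 2) := by
    rw [abs_sin_rpow_eq_sq_rpow, ← rpow_add hx, show (q / 2 + (-1 - q / 2) : ℝ) = -1 by ring, rpow_neg_one]
    unfold mollB; field_simp; ring
  simp only [Function.comp_def] at h
  rw [e] at h
  exact h.mono_left nhdsWithin_le_nhds

/-- **The zero set of `s ↦ sin(2πs)` is Lebesgue-null** (it is `½ℤ`). [folklore] -/
theorem ae_sin_two_pi_mul_ne_zero : ∀ᵐ s : ℝ, sin (2 * π * s) ≠ 0 := by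
  rw [ae_iff]
  simp only [not_not]
  refine measure_mono_null (fun s hs => ?_) ((Set.countable_range fun n : ℤ => (n : ℝ) / 2).measure_zero volume)
  obtain ⟨n, hn⟩ := sin_eq_zero_iff.1 hs
  exact ⟨n, by field_simp; nlinarith [pi_pos, hn]⟩

/-! ## 4. The limits of `D_ε(q)`, `N_ε(q)` and `R_ε(q)` as `ε ↓ 0` -/

/-- `∫₀¹ sin²(2πs) ds = ½`. [folklore] -/
theorem integral_sin_two_pi_mul_sq : ∫ s in (0 : ℝ)..1, sin (2 * π * s) ^ 2 = 1 / 2 := by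
  have h2π : (2 * π : ℝ) ≠ 0 := by positivity
  have hπ : (π : ℝ) ≠ 0 := Real.pi_ne_zero
  rw [intervalIntegral.integral_comp_mul_left (fun x => sin x ^ 2) h2π, integral_sin_sq]
  simp
  field_simp

/-- **`D_ε(q) → ½`** as `ε ↓ 0` (`q ≥ 1`; dominated convergence with the constant dominator `2`). [ours] -/
theorem tendsto_mollDen (hq : 1 ≤ q) : Tendsto (mollDen q) (𝓝[>] 0) (𝓝 (1 / 2)) := by
  have hev : ∀ᶠ ε in 𝓝[>] (0 : ℝ), ε ∈ Ioo (0 : ℝ) 1 := Ioo_mem_nhdsGT one_pos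
  have h : Tendsto (mollDen q) (𝓝[>] 0) (𝓝 (∫ s in (0 : ℝ)..1, sin (2 * π * s) ^ 2)) := by
    refine intervalIntegral.tendsto_integral_filter_of_dominated_convergence (fun _ => 2) ?_ ?_
      intervalIntegrable_const ?_
    · exact hev.mono fun ε hε => (continuous_mollDenIntegrand hε.1 (by linarith)).aestronglyMeasurable
    · refine hev.mono fun ε hε => Eventually.of_forall fun s _ => ?_
      obtain ⟨h0, h2⟩ := mollDenIntegrand_mem (q := q) (by linarith) hε.1 hε.2.le s
      rw [Real.norm_eq_abs, abs_of_nonneg h0]; exact h2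
    · exact ae_sin_two_pi_mul_ne_zero.mono fun s hs _ => tendsto_mollDenIntegrand hs
  rwa [integral_sin_two_pi_mul_sq] at h

/-- `∫₀¹ (1+2α)(2α − (1+2α)S²) = 2(1−q)/q²` (`q ≠ 0`). [ours, bookkeeping] -/
theorem integral_mollNumLimit (hq : q ≠ 0) :
    ∫ s in (0 : ℝ)..1, (1 + 2 * mollExp q) * (2 * mollExp q - (1 + 2 * mollExp q) * sin (2 * π * s) ^ 2) =
      2 * (1 - q) / q ^ 2 := by
  have hi : IntervalIntegrable (fun s : ℝ => (1 + 2 * mollExp q) ^ 2 * sin (2 * π * s) ^ 2) volume 0 1 := by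
    apply Continuous.intervalIntegrable; fun_prop
  have e : (fun s : ℝ => (1 + 2 * mollExp q) * (2 * mollExp q - (1 + 2 * mollExp q) * sin (2 * π * s) ^ 2)) =
      fun s => (1 + 2 * mollExp q) * (2 * mollExp q) - (1 + 2 * mollExp q) ^ 2 * sin (2 * π * s) ^ 2 := by
    funext s; ring
  rw [e, intervalIntegral.integral_sub intervalIntegrable_const hi, intervalIntegral.integral_const,
    intervalIntegral.integral_const_mul, integral_sin_two_pi_mul_sq]
  unfold mollExp
  simp only [sub_zero, smul_eq_mul, one_mul]
  field_simp
  ring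

/-- **`N_ε(q) → 2(1−q)/q²`** as `ε ↓ 0` (`q ≥ 1`; dominated convergence with the constant dominator `14`). [ours] -/
theorem tendsto_mollNum (hq : 1 ≤ q) : Tendsto (mollNum q) (𝓝[>] 0) (𝓝 (2 * (1 - q) / q ^ 2)) := by
  have hev : ∀ᶠ ε in 𝓝[>] (0 : ℝ), ε ∈ Ioo (0 : ℝ) 1 := Ioo_mem_nhdsGT one_pos
  have h : Tendsto (mollNum q) (𝓝[>] 0)
      (𝓝 (∫ s in (0 : ℝ)..1, (1 + 2 * mollExp q) * (2 * mollExp q - (1 + 2 * mollExp q) * sin (2 * π * s) ^ 2))) := by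
    refine intervalIntegral.tendsto_integral_filter_of_dominated_convergence (fun _ => 14) ?_ ?_
      intervalIntegrable_const ?_
    · exact hev.mono fun ε hε => (continuous_mollNumIntegrand hε.1 (by linarith)).aestronglyMeasurable
    · exact hev.mono fun ε hε => Eventually.of_forall fun s _ => by
        rw [Real.norm_eq_abs]; exact abs_mollNumIntegrand_le hq hε.1 hε.2.le s
    · exact ae_sin_two_pi_mul_ne_zero.mono fun s hs _ => tendsto_mollNumIntegrand hs
  rwa [integral_mollNumLimit (q := q) (by positivity)] at h

/-- **`R_ε(q) → 16π²(q−1)/q`** as `ε ↓ 0` (`q ≥ 1`). [ours] -/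
theorem tendsto_mollRate (hq : 1 ≤ q) : Tendsto (mollRate q) (𝓝[>] 0) (𝓝 (16 * π ^ 2 * (q - 1) / q)) := by
  have hq0 : q ≠ 0 := by positivity
  have h := ((tendsto_mollNum hq).const_mul (4 * π ^ 2 * q)).neg.div (tendsto_mollDen hq) (by norm_num)
  have e : -(4 * π ^ 2 * q * (2 * (1 - q) / q ^ 2)) / (1 / 2) = 16 * π ^ 2 * (q - 1) / q := by
    field_simp; ring
  rw [e] at h
  exact h

/-! ## 5. The optimal laminate ceiling -/

/-- **THEOREM (optimal laminate ceiling). `C_λ(q) ≤ 16π²(q−1)/q` for every real `q ≥ 1`.** [ours] -/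
theorem topEigHeatRate_le_optimal (hq : 1 ≤ q) : topEigHeatRate q ≤ 16 * π ^ 2 * (q - 1) / q :=
  ge_of_tendsto (tendsto_mollRate hq) (eventually_mem_nhdsWithin.mono fun _ hε =>
    topEigHeatRate_le_mollRate hq hε)

/-- **`C_λ^−(q) ≤ 16π²(q−1)/q`** for every real `q ≥ 1`. [ours] -/
theorem negBotEigHeatRate_le_optimal (hq : 1 ≤ q) : negBotEigHeatRate q ≤ 16 * π ^ 2 * (q - 1) / q := by
  rw [negBotEigHeatRate_eq]; exact topEigHeatRate_le_optimal hq

/-- **`C_λ^sym(q) ≤ 16π²(q−1)/q`** for every real `q ≥ 1` (K6's symmetrised window). [ours] -/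
theorem topBotEigHeatRate_le_optimal (hq : 1 ≤ q) : topBotEigHeatRate q ≤ 16 * π ^ 2 * (q - 1) / q :=
  ge_of_tendsto (tendsto_mollRate hq) (eventually_mem_nhdsWithin.mono fun _ hε =>
    topBotEigHeatRate_le_mollRate hq hε)

/-- **Every rate above `16π²(q−1)/q` is REFUTED for `∫(λ₁⁺)^q`** (`q ≥ 1`). [ours] -/
theorem not_topEigHeatCoercive_of_optimal_lt (hq : 1 ≤ q) {c : ℝ} (hc : 16 * π ^ 2 * (q - 1) / q < c) :
    ¬ TopEigHeatCoercive (d := Fin 3) q c := fun h =>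
  not_le.2 (hc.trans_le' (topEigHeatRate_le_optimal hq)) ((topEigHeatCoercive_iff_le_rate hq).1 h)

/-- **The kernel window: `C_λ(q) ∈ [0, 16π²(q−1)/q]`** for every real `q ≥ 1`. [ours] -/
theorem topEigHeatRate_mem_Icc_optimal (hq : 1 ≤ q) :
    topEigHeatRate q ∈ Icc (0 : ℝ) (16 * π ^ 2 * (q - 1) / q) :=
  ⟨topEigHeatRate_nonneg hq, topEigHeatRate_le_optimal hq⟩

/-! ## 6. Comparisons with the recorded ceilings (exact arithmetic) -/

/-- **`16π²(q−1)/q ≤ 4π²q`** for `q > 0` (`⟺ (q−2)² ≥ 0`): the Poincaré ceiling is never better. [ours, bookkeeping] -/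
theorem optimal_le_poincare (hq : 0 < q) : 16 * π ^ 2 * (q - 1) / q ≤ 4 * π ^ 2 * q := by
  rw [div_le_iff₀ hq]; nlinarith [sq_nonneg (q - 2), pi_pos, sq_nonneg π]

/-- **`16π²(q−1)/q < 4π²q`** for `q > 0`, `q ≠ 2`: strictly better than Poincaré off `q = 2`. [ours, bookkeeping] -/
theorem optimal_lt_poincare (hq : 0 < q) (h2 : q ≠ 2) : 16 * π ^ 2 * (q - 1) / q < 4 * π ^ 2 * q := by
  rw [div_lt_iff₀ hq]
  have : 0 < (q - 2) ^ 2 := by positivity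
  nlinarith [pi_pos, sq_nonneg π, mul_pos (mul_pos (by positivity : (0:ℝ) < π ^ 2) this) hq]

/-- At `q = 2` the two ceilings agree: `16π²(2−1)/2 = 8π² = 4π²·2` (laminate rigidity, `TopEigLaminateTwo`). [ours, bookkeeping] -/
theorem optimal_two : 16 * π ^ 2 * ((2 : ℝ) - 1) / 2 = 8 * π ^ 2 := by ring

/-- **`16π²(q−1)/q ≤ 18π²(q−1)`** for `q ≥ 1` (K33b's linear bound). [ours, bookkeeping] -/
theorem optimal_le_linear (hq : 1 ≤ q) : 16 * π ^ 2 * (q - 1) / q ≤ 18 * π ^ 2 * (q - 1) := by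
  rw [div_le_iff₀ (by linarith)]; nlinarith [pi_pos, sq_nonneg π, mul_nonneg (sq_nonneg π) (sub_nonneg.2 hq)]

/-- **`16π²(q−1)/q < 36π²q(q−1)/(3q−1)`** for `q > 1` (K33b's `R_λ(q)`; `⟺ 4(3q−1) < 9q²`). [ours, bookkeeping] -/
theorem optimal_lt_lamRate (hq : 1 < q) : 16 * π ^ 2 * (q - 1) / q < 36 * π ^ 2 * q * (q - 1) / (3 * q - 1) := by
  have h3 : 0 < 3 * q - 1 := by linarith
  rw [div_lt_div_iff₀ (by linarith) h3]
  have key : 36 * π ^ 2 * q * (q - 1) * q - 16 * π ^ 2 * (q - 1) * (3 * q - 1) =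
      4 * π ^ 2 * (q - 1) * (3 * q - 2) ^ 2 := by ring
  have hpos : 0 < 4 * π ^ 2 * (q - 1) * (3 * q - 2) ^ 2 := by
    have := pi_pos
    have h1 : 0 < q - 1 := by linarith
    have h2 : 0 < 3 * q - 2 := by linarith
    positivity
  linarith [key, hpos]

/-- Sample windows: `C_λ(3/2) ≤ 16π²/3`, `C_λ(3) ≤ 32π²/3`, `C_λ(4) ≤ 12π²`. [ours, bookkeeping] -/
theorem topEigHeatRate_samples :
    topEigHeatRate (3 / 2) ≤ 16 * π ^ 2 / 3 ∧ topEigHeatRate 3 ≤ 32 * π ^ 2 / 3 ∧ topEigHeatRate 4 ≤ 12 * π ^ 2 := by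
  refine ⟨(topEigHeatRate_le_optimal (by norm_num)).trans (le_of_eq (by ring)),
    (topEigHeatRate_le_optimal (by norm_num)).trans (le_of_eq (by ring)),
    (topEigHeatRate_le_optimal (by norm_num)).trans (le_of_eq (by ring))⟩

end TopEigLaminate

end Summit.NavierStokesRegularity.FunctionalMining

end
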